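import Literature.Barriers.Parity.SiegelZeroQuadraticPolynomialsRangesA
import Literature.Barriers.Parity.SiegelZeroQuadraticPolynomialsRangesB
import HarnessLib

/-!
# Granville–Mollin's Theorem 4: the explicit main estimate

Topic `Literature/Barriers/Parity`, penultimate layer of the proof of
`Literature.Barriers.Parity.GranvilleMollin2000_thm4` (Granville–Mollin, *Rabinowitsch revisited*,
Acta Arith. 96 (2000), Theorem 4, §6A–6B). Everything is PROVED; no definition is introduced.
For `d = −q`, `q ≡ 3 (mod 8)`, `q ≤ N`, a sieving level `y` (`2 ≤ y ≤ √q`, `y ≤ q^{9.5} ≤ N/16`) and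
a dyadic exponent `M` with `2^M ≤ y⁴ < 2^{M+1}`, `q^{9.5} ≤ N/2^{M+1}`, and the two analytic inputs
in instantiated form — the (5.5)-type bound `∑_{p ≤ t} ω(p) log p ≤ K_c t log t` on
`[q^{9.5}, X₁)`, `X₁ > 2N`, and the Heath-Brown bound `∑_{p ≤ q^500} ω(p) log p/p ≤ H` — this
file proves:

* `errorTotal_le` — the full error term of (6.1),
  `∑_{y ≤ q' ≤ √2 N} ∑_r #{n ∈ apIndex N q' r : (f_d(n), P(y)) = 1} ≤ E`, with the explicit
  `E = P0 + I + IIa + IIb` of `…RangesA.lean`, `…RangesB.lean` (splitting the primes `q'` at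
  `q^{9.5}`, `N/2^{M+1}`, `N/16`).
* `abs_polyPrimeCount_sub_mul_le` — **the main estimate**:
  `|π_{f_d}(N) − ϱ_d N| ≤ Cω N V(y) e^{−log √N/log y} + √N e⁸ log² y + √y + 1 + E +
  ϱ_d N (exp(H/log y + 16/y) − 1)`, together with `ϱ_d ≤ V(y) ≤ ϱ_d exp(H/log y + 16/y)`
  (`gmRho_le_prod_primesBelow`, `prod_primesBelow_le_gmRho_mul_exp` of `…OmegaSums.lean`).

The choice of `y = q^ε`, of the `N`-range `q^{10} ≤ N ≤ q^{δη}` and of the thresholds, turning this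
into `|π_f(N) − ϱ_d N| ≤ ε₀ ϱ_d N`, is `SiegelZeroQuadraticPolynomialsTheorem4.lean`.

[cite: GranvilleMollin2000, Theorem 4, §6A (6.1) and §6B (6.2)]
-/

noncomputable section

open Finset Real Polynomial
open Literature.NumberTheory.Sieve

namespace Literature.Barriers.Parity

/-- **The error term of (6.1), all ranges**: under the hypotheses described in the module
docstring, `∑_{q' prime, ⌈y⌉ ≤ q' ≤ ⌊√2 N⌋} ∑_r T(q', r) ≤ P0 + I + IIa + IIb` with
`P0 = 17 · 4K_c (N/16) · 31`, `I = (1 + Cω) N V (H/log y + H/log √q) + e⁸ log² y · 17 √N √(q^{9.5})`,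
`IIa = (1 + Cω) N V · 4K_c log N/log 2 + e⁸ log² y · 12 K_c N`,
`IIb = (1 + Cω) N · 4K_c (3√(Kω V (4 log y/log 2)²) + 1) + (e⁸/16) 1536 K_c N` (`V = V(y)`).
[cite: GranvilleMollin2000, §6B (6.2)] -/
theorem errorTotal_le {d : ℤ} {q N : ℕ} (hdq : d = -(q : ℤ)) (hq8 : q % 8 = 3) (hqN : q ≤ N)
    (hN : 2 ≤ N) {y Kc X₁ H : ℝ} (hy : 2 ≤ y) (hysq : y ≤ Real.sqrt q) (hKc : 0 ≤ Kc)
    (h55 : ∀ t : ℝ, (q : ℝ) ^ ((19 : ℝ) / 2) ≤ t → t < X₁ →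
      ∑ p ∈ Nat.primesLE ⌊t⌋₊, (polyRootCountMod ![rabinowitschPoly d] p : ℝ) * Real.log p ≤
        Kc * (t * Real.log t))
    (hX₁ : 2 * (N : ℝ) < X₁)
    (hH : ∑ p ∈ Nat.primesLE ⌊(q : ℝ) ^ (500 : ℝ)⌋₊,
        (polyRootCountMod ![rabinowitschPoly d] p : ℝ) * Real.log p / p ≤ H)
    (hq95 : 2 ≤ (q : ℝ) ^ ((19 : ℝ) / 2)) (hyq : y ≤ (q : ℝ) ^ ((19 : ℝ) / 2))
    (hN16 : (q : ℝ) ^ ((19 : ℝ) / 2) ≤ (N : ℝ) / 16) {M : ℕ} (hM3 : 3 ≤ M)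
    (hMy : (2 : ℝ) ^ M ≤ y ^ 4) (hyM : y ^ 4 < (2 : ℝ) ^ (M + 1))
    (hxM : (q : ℝ) ^ ((19 : ℝ) / 2) ≤ (N : ℝ) / 2 ^ (M + 1)) :
    ∑ q' ∈ (Nat.primesLE ⌊Real.sqrt 2 * N⌋₊).filter (fun q' => ⌈y⌉₊ ≤ q'),
      ∑ r ∈ (range q').filter (fun r : ℕ => (q' : ℤ) ∣ (rabinowitschPoly d).eval (r : ℤ)),
        (#((apIndex N q' r).filter fun n : ℕ =>
          ((rabinowitschPoly d).eval (n : ℤ)).natAbs.Coprime (primesProdBelow y)) : ℝ) ≤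
      17 * (4 * Kc * ((N : ℝ) / 16) * ((2 : ℝ) ^ 5 - 1)) +
      ((1 + SieveSequence.flConst 2 (2 * Real.exp (17 + 12 / Real.log 2))) * N *
          (∏ p ∈ Nat.primesBelow ⌈y⌉₊, (1 - (polyRootCountMod ![rabinowitschPoly d] p : ℝ) / p)) *
          (H / Real.log y + H / Real.log (Real.sqrt q)) +
        Real.exp 8 * Real.log y ^ 2 * (17 * Real.sqrt N * Real.sqrt ((q : ℝ) ^ ((19 : ℝ) / 2)))) +
      ((1 + SieveSequence.flConst 2 (2 * Real.exp (17 + 12 / Real.log 2))) * N *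
          (∏ p ∈ Nat.primesBelow ⌈y⌉₊, (1 - (polyRootCountMod ![rabinowitschPoly d] p : ℝ) / p)) *
          (4 * Kc * (Real.log N / Real.log 2)) +
        Real.exp 8 * Real.log y ^ 2 * (12 * Kc * N)) +
      ((1 + SieveSequence.flConst 2 (2 * Real.exp (17 + 12 / Real.log 2))) * N *
          (4 * Kc * (3 * Real.sqrt ((2 * Real.exp (17 + 12 / Real.log 2)) *
            (∏ p ∈ Nat.primesBelow ⌈y⌉₊, (1 - (polyRootCountMod ![rabinowitschPoly d] p : ℝ) / p)) *
            (4 * Real.log y / Real.log 2) ^ 2) + 1)) +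
        Real.exp 8 / 16 * (1536 * Kc * N)) := by
  set Q95 : ℝ := (q : ℝ) ^ ((19 : ℝ) / 2) with hQ95
  have hy0 : 0 < y := by linarith
  have hy1 : 1 ≤ y := by linarith
  have hN0 : (0 : ℝ) < N := by exact_mod_cast (show 0 < N by omega)
  have hlog2 : 0 < Real.log 2 := Real.log_pos one_lt_two
  -- thresholds
  set a₀ : ℕ := ⌈y⌉₊ - 1 with ha₀
  set b₁ : ℕ := ⌊Q95⌋₊ with hb₁
  set b₂ : ℕ := ⌊(N : ℝ) / 2 ^ (M + 1)⌋₊ with hb₂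
  set b₃ : ℕ := ⌊(2 : ℝ) ^ (M - 3) * ((N : ℝ) / 2 ^ (M + 1))⌋₊ with hb₃
  set b₄ : ℕ := ⌊(2 : ℝ) ^ 5 * ((N : ℝ) / 16)⌋₊ with hb₄
  have h16 : (2 : ℝ) ^ (M - 3) * ((N : ℝ) / 2 ^ (M + 1)) = (N : ℝ) / 16 := two_pow_sub_three_mul hM3 N
  have hb₃' : b₃ = ⌊(N : ℝ) / 16⌋₊ := by rw [hb₃, h16]
  have h01 : a₀ ≤ b₁ := by
    have h1 : ⌈y⌉₊ ≤ ⌈Q95⌉₊ := Nat.ceil_mono hyq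
    have h2 : ⌈Q95⌉₊ ≤ ⌊Q95⌋₊ + 1 := Nat.ceil_le_floor_add_one _
    omega
  have h12 : b₁ ≤ b₂ := Nat.floor_le_floor hxM
  have h23 : b₂ ≤ b₃ := by
    rw [hb₃']
    refine Nat.floor_le_floor (div_le_div_of_nonneg_left hN0.le (by norm_num) ?_)
    calc (16 : ℝ) = 2 ^ 4 := by norm_num
      _ ≤ 2 ^ (M + 1) := pow_le_pow_right₀ (by norm_num) (by omega)
  have h34 : b₃ ≤ b₄ := by
    rw [hb₃']
    exact Nat.floor_le_floor (by norm_num; linarith)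
  -- `T ⊆ (a₀, b₄]`
  have hsub : (Nat.primesLE ⌊Real.sqrt 2 * N⌋₊).filter (fun q' => ⌈y⌉₊ ≤ q') ⊆
      (Nat.primesLE b₄).filter (fun q' => a₀ < q') := by
    intro p hp
    rw [mem_filter, Nat.mem_primesLE] at hp ⊢
    have hceil1 : 1 ≤ ⌈y⌉₊ := Nat.one_le_iff_ne_zero.mpr (Nat.ceil_pos.mpr hy0).ne'
    refine ⟨⟨hp.1.1.trans (Nat.floor_le_floor ?_), hp.1.2⟩, by omega⟩
    have hs2 : Real.sqrt 2 ≤ 2 := by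
      calc Real.sqrt 2 ≤ Real.sqrt (2 ^ 2) := Real.sqrt_le_sqrt (by norm_num)
        _ = 2 := Real.sqrt_sq (by norm_num)
    calc Real.sqrt 2 * N ≤ 2 * N := mul_le_mul_of_nonneg_right hs2 hN0.le
      _ = (2 : ℝ) ^ 5 * ((N : ℝ) / 16) := by norm_num; ring
  -- nonnegativity of the summand
  have hnn : ∀ q' ∈ (Nat.primesLE b₄).filter (fun q' => a₀ < q'),
      0 ≤ ∑ r ∈ (range q').filter (fun r : ℕ => (q' : ℤ) ∣ (rabinowitschPoly d).eval (r : ℤ)),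
        (#((apIndex N q' r).filter fun n : ℕ =>
          ((rabinowitschPoly d).eval (n : ℤ)).natAbs.Coprime (primesProdBelow y)) : ℝ) :=
    fun _ _ => sum_nonneg fun _ _ => Nat.cast_nonneg _
  refine (sum_le_sum_of_subset_of_nonneg hsub fun q' hq' _ => hnn q' hq').trans ?_
  -- split the window `(a₀, b₄]` at `b₁, b₂, b₃`
  rw [sum_primesLE_filter_lt_split (h01.trans (h12.trans h23)) h34,
    sum_primesLE_filter_lt_split (h01.trans h12) h23, sum_primesLE_filter_lt_split h01 h12]
  -- derived size facts
  have hy4Q : y ^ 4 * Q95 ≤ N := by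
    have h2M : (0 : ℝ) < 2 ^ (M + 1) := by positivity
    have : Q95 * 2 ^ (M + 1) ≤ N := (le_div_iff₀ h2M).mp hxM
    nlinarith [hyM, show 0 ≤ Q95 by linarith]
  have hu2 : 2 * ((N : ℝ) / 2 ^ (M + 1)) ≤ N := by
    rw [mul_div_assoc', div_le_iff₀ (by positivity)]
    have : (2 : ℝ) ≤ 2 ^ (M + 1) := by
      calc (2 : ℝ) = 2 ^ 1 := by norm_num
        _ ≤ 2 ^ (M + 1) := pow_le_pow_right₀ (by norm_num) (by omega)
    nlinarith
  have hyu : y ^ 2 * ((N : ℝ) / 2 ^ (M + 1)) ≤ N := by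
    have hy24 : y ^ 2 ≤ y ^ 4 := pow_le_pow_right₀ hy1 (by norm_num)
    have h2M : (0 : ℝ) < 2 ^ (M + 1) := by positivity
    rw [mul_div_assoc', div_le_iff₀ h2M]
    nlinarith
  have hMylog : (M : ℝ) * Real.log 2 ≤ 4 * Real.log y := by
    have := Real.log_le_log (by positivity) hMy
    rwa [Real.log_pow, Real.log_pow] at this
  have hNX₁ : (N : ℝ) < X₁ := by linarith
  -- the four ranges
  have hI := sum_rangeI_le hdq hq8 hqN hN hy hysq hy4Q hH
  have hIIa := sum_rangeIIa_le hdq hq8 hqN hN hy hKc h55 hq95 hyq hxM hu2 hNX₁ hyu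
  have hIIb := sum_rangeIIb_le hdq hq8 hqN hN hy hKc h55 hq95 hyq hM3 hMylog hxM hNX₁
  have hP0 := sum_rangeP0_le (d := d) hKc h55 hq95 hN16 hX₁ y
  rw [← hb₃', ← hb₄] at hP0
  rw [← ha₀, ← hb₁] at hI
  rw [← hb₂, ← hb₁] at hIIa
  rw [← hb₃, ← hb₂] at hIIb
  linarith [hI, hIIa, hIIb, hP0]

/-- **Combining the two directions of (6.1)** (real bookkeeping): from `P ≤ S + a`, `S ≤ P + E`,
`|S − N V| ≤ b`, `ϱ ≤ V ≤ ϱ e^{t}` and `N ≥ 0`: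
`|P − ϱ N| ≤ b + a + E + ϱ N (e^{t} − 1)`. [folklore] -/
theorem abs_sub_le_of_sandwich {P S a E b N V ϱ t : ℝ} (h1 : P ≤ S + a) (h2 : S ≤ P + E)
    (h3 : |S - N * V| ≤ b) (h4 : ϱ ≤ V) (h5 : V ≤ ϱ * Real.exp t) (hN : 0 ≤ N) (hE : 0 ≤ E)
    (ha : 0 ≤ a) :
    |P - ϱ * N| ≤ b + a + E + ϱ * N * (Real.exp t - 1) := by
  have h3' := abs_le.mp h3
  have hV1 : N * V ≤ ϱ * N * Real.exp t := by nlinarith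
  have hV2 : ϱ * N ≤ N * V := by nlinarith
  rw [abs_le]
  constructor <;> nlinarith

/-- **The main estimate for Theorem 4** (everything explicit; `V = V(y) = ∏_{p<y}(1 − ω(p)/p)`):
under the hypotheses of `errorTotal_le` and `5 ≤ y`, `y ≤ √N`, `q ≥ 7`,
`|π_{f_d}(N) − ϱ_d N| ≤ [Cω N V e^{−log √N/log y} + √N e⁸ log² y] + [√y + 1] + E +
ϱ_d N (exp(H/log y + 16/y) − 1)`, with `E` the bound of `errorTotal_le`.
[cite: GranvilleMollin2000, Theorem 4, §6A–6B] -/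
theorem abs_polyPrimeCount_sub_mul_le {d : ℤ} {q N : ℕ} (hdq : d = -(q : ℤ)) (hq8 : q % 8 = 3)
    (hq7 : 7 ≤ q) (hqN : q ≤ N) (hN : 2 ≤ N) {y Kc X₁ H : ℝ} (hy : 5 ≤ y) (hysq : y ≤ Real.sqrt q)
    (hyN : y ≤ Real.sqrt N) (hKc : 0 ≤ Kc)
    (h55 : ∀ t : ℝ, (q : ℝ) ^ ((19 : ℝ) / 2) ≤ t → t < X₁ →
      ∑ p ∈ Nat.primesLE ⌊t⌋₊, (polyRootCountMod ![rabinowitschPoly d] p : ℝ) * Real.log p ≤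
        Kc * (t * Real.log t))
    (hX₁ : 2 * (N : ℝ) < X₁) (hH0 : 0 ≤ H)
    (hH : ∑ p ∈ Nat.primesLE ⌊(q : ℝ) ^ (500 : ℝ)⌋₊,
        (polyRootCountMod ![rabinowitschPoly d] p : ℝ) * Real.log p / p ≤ H)
    (hq95 : 2 ≤ (q : ℝ) ^ ((19 : ℝ) / 2)) (hyq : y ≤ (q : ℝ) ^ ((19 : ℝ) / 2))
    (hN16 : (q : ℝ) ^ ((19 : ℝ) / 2) ≤ (N : ℝ) / 16) {M : ℕ} (hM3 : 3 ≤ M)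
    (hMy : (2 : ℝ) ^ M ≤ y ^ 4) (hyM : y ^ 4 < (2 : ℝ) ^ (M + 1))
    (hxM : (q : ℝ) ^ ((19 : ℝ) / 2) ≤ (N : ℝ) / 2 ^ (M + 1)) :
    |(polyPrimeCount ![rabinowitschPoly d] N : ℝ) - gmRho d * N| ≤
      (SieveSequence.flConst 2 (2 * Real.exp (17 + 12 / Real.log 2)) * N *
          (∏ p ∈ Nat.primesBelow ⌈y⌉₊, (1 - (polyRootCountMod ![rabinowitschPoly d] p : ℝ) / p)) *
          Real.exp (-(Real.log (Real.sqrt N) / Real.log y)) +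
        Real.sqrt N * (Real.exp 8 * Real.log y ^ 2)) +
      (Real.sqrt y + 1) +
      (17 * (4 * Kc * ((N : ℝ) / 16) * ((2 : ℝ) ^ 5 - 1)) +
      ((1 + SieveSequence.flConst 2 (2 * Real.exp (17 + 12 / Real.log 2))) * N *
          (∏ p ∈ Nat.primesBelow ⌈y⌉₊, (1 - (polyRootCountMod ![rabinowitschPoly d] p : ℝ) / p)) *
          (H / Real.log y + H / Real.log (Real.sqrt q)) +
        Real.exp 8 * Real.log y ^ 2 * (17 * Real.sqrt N * Real.sqrt ((q : ℝ) ^ ((19 : ℝ) / 2)))) +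
      ((1 + SieveSequence.flConst 2 (2 * Real.exp (17 + 12 / Real.log 2))) * N *
          (∏ p ∈ Nat.primesBelow ⌈y⌉₊, (1 - (polyRootCountMod ![rabinowitschPoly d] p : ℝ) / p)) *
          (4 * Kc * (Real.log N / Real.log 2)) +
        Real.exp 8 * Real.log y ^ 2 * (12 * Kc * N)) +
      ((1 + SieveSequence.flConst 2 (2 * Real.exp (17 + 12 / Real.log 2))) * N *
          (4 * Kc * (3 * Real.sqrt ((2 * Real.exp (17 + 12 / Real.log 2)) *
            (∏ p ∈ Nat.primesBelow ⌈y⌉₊, (1 - (polyRootCountMod ![rabinowitschPoly d] p : ℝ) / p)) *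
            (4 * Real.log y / Real.log 2) ^ 2) + 1)) +
        Real.exp 8 / 16 * (1536 * Kc * N))) +
      gmRho d * N * (Real.exp (H / Real.log y + 16 / y) - 1) := by
  have hy2 : 2 ≤ y := by linarith
  have hq3 : 3 ≤ q := by omega
  have hy1 : 1 < y := by linarith
  -- the two directions of (6.1)
  have h1 := rabinowitsch_polyPrimeCount_le hdq hq3 N y
  have h2 := rabinowitsch_card_coprime_le hdq hq7 hqN hN y
  have hE := errorTotal_le hdq hq8 hqN hN hy2 hysq hKc h55 hX₁ hH hq95 hyq hN16 hM3 hMy hyM hxM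
  -- main term
  have h3 := rabinowitsch_abs_card_coprime_sub_le hdq hq8 hqN hy2 hyN
  -- `ϱ ≤ V ≤ ϱ e^t`
  have h4 := gmRho_le_prod_primesBelow hdq hq8 hysq
  have hceil1 : 1 ≤ ⌈y⌉₊ := Nat.one_le_iff_ne_zero.mpr (Nat.ceil_pos.mpr (by linarith)).ne'
  have ha₀y : y ≤ ((⌈y⌉₊ - 1 : ℕ) : ℝ) + 1 := by
    have : ((⌈y⌉₊ - 1 : ℕ) : ℝ) + 1 = ⌈y⌉₊ := by push_cast [Nat.cast_sub hceil1]; ring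
    rw [this]; exact Nat.le_ceil y
  have hq1 : (1 : ℝ) ≤ q := by exact_mod_cast (show 1 ≤ q by omega)
  have hT : ∑ p ∈ (Nat.primesLE ⌊Real.sqrt q⌋₊).filter (fun p => ⌈y⌉₊ - 1 < p),
      (polyRootCountMod ![rabinowitschPoly d] p : ℝ) / p ≤ H / Real.log y := by
    refine sum_omega_div_window_le_of_weighted hy1 ha₀y (Nat.floor_le_floor ?_) hH
    rw [Real.sqrt_eq_rpow]; exact Real.rpow_le_rpow_of_exponent_le hq1 (by norm_num)
  have h5 := prod_primesBelow_le_gmRho_mul_exp hdq hq8 hy hysq hT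
  have hEnn : 0 ≤ ∑ q' ∈ (Nat.primesLE ⌊Real.sqrt 2 * N⌋₊).filter (fun q' => ⌈y⌉₊ ≤ q'),
      ∑ r ∈ (range q').filter (fun r : ℕ => (q' : ℤ) ∣ (rabinowitschPoly d).eval (r : ℤ)),
        (#((apIndex N q' r).filter fun n : ℕ =>
          ((rabinowitschPoly d).eval (n : ℤ)).natAbs.Coprime (primesProdBelow y)) : ℝ) :=
    sum_nonneg fun _ _ => sum_nonneg fun _ _ => Nat.cast_nonneg _
  have h1' : (polyPrimeCount ![rabinowitschPoly d] N : ℝ) ≤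
      #((Ioc 0 N).filter fun n : ℕ =>
          ((rabinowitschPoly d).eval (n : ℤ)).natAbs.Coprime (primesProdBelow y)) +
        (Real.sqrt y + 1) := by linarith [h1]
  have key := abs_sub_le_of_sandwich h1' h2 h3 h4 h5 (Nat.cast_nonneg N) hEnn (by positivity)
  have hρ0 : 0 ≤ gmRho d * N := mul_nonneg (gmRho_pos hdq hq8).le (Nat.cast_nonneg N)
  have hexp : 0 ≤ Real.exp (H / Real.log y + 16 / y) - 1 := by
    have : 0 ≤ H / Real.log y + 16 / y := by
      have := Real.log_pos hy1
      positivity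
    linarith [Real.add_one_le_exp (H / Real.log y + 16 / y)]
  linarith [key, hE, mul_nonneg hρ0 hexp]


/-! ### Sharper treatment of the range `q^{9.5} < q' ≤ N/2^{M+1}`

In `sum_rangeIIa_le` (`…RangesA.lean`) the sieve remainder of a progression was recorded as
`√X e⁸ log² y`; since `X = N/q' ≥ y⁴` on this range, `log² y ≤ log² X/16`, and the remainder sum
is then `O(K_c N)` (without the factor `log² y`) by `sum_omega_sqrt_logsq_dyadic_le`, exactly as
in the range `N/2^{M+1} < q' ≤ N/16`. This is the form needed in the final summation. -/

/-- **Range IIa, sharp remainder** (`q^{9.5} < q' ≤ u`, `y⁴ u ≤ N`, `2u ≤ N`): under the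
hypotheses of `sum_rangeIIa_le` with `y⁴ u ≤ N`,
`∑_{q^{9.5} < q' ≤ u} ∑_r T(q', r) ≤ (1 + Cω) N V(y) · 4K_c log N/log 2 + (e⁸/16) · 1536 K_c N`.
[cite: GranvilleMollin2000, §6B (6.2)] -/
theorem sum_rangeIIa_le' {d : ℤ} {q N : ℕ} (hdq : d = -(q : ℤ)) (hq8 : q % 8 = 3) (hqN : q ≤ N)
    (hN : 2 ≤ N) {y Kc X₁ u : ℝ} (hy : 2 ≤ y) (hKc : 0 ≤ Kc)
    (h55 : ∀ t : ℝ, (q : ℝ) ^ ((19 : ℝ) / 2) ≤ t → t < X₁ →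
      ∑ p ∈ Nat.primesLE ⌊t⌋₊, (polyRootCountMod ![rabinowitschPoly d] p : ℝ) * Real.log p ≤
        Kc * (t * Real.log t))
    (hq95 : 2 ≤ (q : ℝ) ^ ((19 : ℝ) / 2)) (hyq : y ≤ (q : ℝ) ^ ((19 : ℝ) / 2))
    (hu : (q : ℝ) ^ ((19 : ℝ) / 2) ≤ u) (huN : 2 * u ≤ N)
    (hX₁ : (N : ℝ) < X₁) (hyu : y ^ 4 * u ≤ N) :
    ∑ q' ∈ (Nat.primesLE ⌊u⌋₊).filter (fun q' => ⌊(q : ℝ) ^ ((19 : ℝ) / 2)⌋₊ < q'),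
      ∑ r ∈ (range q').filter (fun r : ℕ => (q' : ℤ) ∣ (rabinowitschPoly d).eval (r : ℤ)),
        (#((apIndex N q' r).filter fun n : ℕ =>
          ((rabinowitschPoly d).eval (n : ℤ)).natAbs.Coprime (primesProdBelow y)) : ℝ) ≤
      (1 + SieveSequence.flConst 2 (2 * Real.exp (17 + 12 / Real.log 2))) * N *
          (∏ p ∈ Nat.primesBelow ⌈y⌉₊, (1 - (polyRootCountMod ![rabinowitschPoly d] p : ℝ) / p)) *
          (4 * Kc * (Real.log N / Real.log 2)) +
        Real.exp 8 / 16 * (1536 * Kc * N) := by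
  set Q95 : ℝ := (q : ℝ) ^ ((19 : ℝ) / 2) with hQ95
  set V := ∏ p ∈ Nat.primesBelow ⌈y⌉₊, (1 - (polyRootCountMod ![rabinowitschPoly d] p : ℝ) / p) with hV
  obtain ⟨h2, hle⟩ := rabinowitsch_omega_hyps hdq hq8
  have hV0 : 0 ≤ V := (prod_one_sub_rootCount_pos h2 hle y).le
  have hQ0 : 0 < Q95 := by linarith
  have hQ1 : 1 ≤ Q95 := by linarith
  have hu0 : 0 < u := lt_of_lt_of_le hQ0 hu
  have hN0 : (0 : ℝ) < N := by linarith
  have hy1 : 1 ≤ y := by linarith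
  have hlogy0 : 0 ≤ Real.log y := Real.log_nonneg hy1
  -- per-progression bound on the range, with `log² y ≤ log²(N/q')/16`
  have hper : ∀ q' ∈ (Nat.primesLE ⌊u⌋₊).filter (fun q' => ⌊Q95⌋₊ < q'),
      ∑ r ∈ (range q').filter (fun r : ℕ => (q' : ℤ) ∣ (rabinowitschPoly d).eval (r : ℤ)),
        (#((apIndex N q' r).filter fun n : ℕ =>
          ((rabinowitschPoly d).eval (n : ℤ)).natAbs.Coprime (primesProdBelow y)) : ℝ) ≤
        (polyRootCountMod ![rabinowitschPoly d] q' : ℝ) *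
          ((1 + SieveSequence.flConst 2 (2 * Real.exp (17 + 12 / Real.log 2))) * ((N : ℝ) / q') *
              (fun _ : ℕ => V) q' +
            Real.sqrt ((N : ℝ) / q') * Real.log ((N : ℝ) / q') ^ 2 * (Real.exp 8 / 16)) := by
    intro q' hq'
    rw [mem_filter, Nat.mem_primesLE] at hq'
    have hprime := hq'.1.2
    have hq'0 : (0 : ℝ) < q' := by exact_mod_cast hprime.pos
    have hgt : Q95 < q' := (Nat.floor_lt hQ0.le).mp hq'.2
    have hyq' : y ≤ q' := hyq.trans hgt.le
    have hq'u : (q' : ℝ) ≤ u := le_trans (by exact_mod_cast hq'.1.1) (Nat.floor_le hu0.le)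
    have hy4 : y ^ 4 * q' ≤ N := le_trans (mul_le_mul_of_nonneg_left hq'u (by positivity)) hyu
    have hy24 : y ^ 2 ≤ y ^ 4 := pow_le_pow_right₀ hy1 (by norm_num)
    have hy2 : y ^ 2 * q' ≤ N := le_trans (mul_le_mul_of_nonneg_right hy24 hq'0.le) hy4
    have hT := sum_roots_card_le_of_sq_mul_le hdq hq8 hqN hN hy hprime hyq' hy2
    refine hT.trans (mul_le_mul_of_nonneg_left ?_ (Nat.cast_nonneg _))
    -- `log y ≤ log X / 4`, `X = N/q' ≥ y⁴`
    set X : ℝ := (N : ℝ) / q' with hX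
    have hXy : y ^ 4 ≤ X := by rw [hX, le_div_iff₀ hq'0]; exact hy4
    have hy0 : 0 < y := by linarith
    have hlogX : 4 * Real.log y ≤ Real.log X := by
      have := Real.log_le_log (by positivity) hXy
      rwa [Real.log_pow] at this
    have hlogsq : Real.log y ^ 2 ≤ Real.log X ^ 2 / 16 := by
      have h := pow_le_pow_left₀ hlogy0 (show Real.log y ≤ Real.log X / 4 by linarith) 2
      calc Real.log y ^ 2 ≤ (Real.log X / 4) ^ 2 := h
        _ = Real.log X ^ 2 / 16 := by ring
    have hsqrt0 : 0 ≤ Real.sqrt X := Real.sqrt_nonneg X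
    have hrem : Real.sqrt X * (Real.exp 8 * Real.log y ^ 2) ≤
        Real.sqrt X * Real.log X ^ 2 * (Real.exp 8 / 16) := by
      calc Real.sqrt X * (Real.exp 8 * Real.log y ^ 2) ≤ Real.sqrt X * (Real.exp 8 * (Real.log X ^ 2 / 16)) :=
            mul_le_mul_of_nonneg_left (mul_le_mul_of_nonneg_left hlogsq (Real.exp_pos 8).le) hsqrt0
        _ = Real.sqrt X * Real.log X ^ 2 * (Real.exp 8 / 16) := by ring
    simp only []
    linarith
  refine (sum_le_sum hper).trans ?_
  rw [sum_omega_mul_split']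
  -- dyadic cover of `(Q95, u]` from `x = Q95`
  obtain ⟨J₂, hJ₂ge, hJ₂lt⟩ := exists_pow_two_mul_ge_lt hQ0 hu
  have hJ₂N : (2 : ℝ) ^ J₂ * Q95 ≤ N := by linarith
  have hsub : (Nat.primesLE ⌊u⌋₊).filter (fun q' => ⌊Q95⌋₊ < q') ⊆
      (Nat.primesLE ⌊(2 : ℝ) ^ J₂ * Q95⌋₊).filter (fun q' => ⌊Q95⌋₊ < q') := by
    intro p hp
    rw [mem_filter, Nat.mem_primesLE] at hp ⊢
    exact ⟨⟨hp.1.1.trans (Nat.floor_le_floor hJ₂ge), hp.1.2⟩, hp.2⟩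
  have hxj : ∀ j < J₂, Q95 ≤ (2 : ℝ) ^ j * Q95 ∧ 2 ≤ (2 : ℝ) ^ j * Q95 ∧ 2 * ((2 : ℝ) ^ j * Q95) < X₁ := by
    intro j hj
    have h2j : (1 : ℝ) ≤ (2 : ℝ) ^ j := one_le_pow₀ (by norm_num)
    have h1 : Q95 ≤ (2 : ℝ) ^ j * Q95 := le_mul_of_one_le_left hQ0.le h2j
    refine ⟨h1, hq95.trans h1, ?_⟩
    have hj1 : (2 : ℝ) ^ (j + 1) ≤ (2 : ℝ) ^ J₂ := pow_le_pow_right₀ (by norm_num) hj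
    calc 2 * ((2 : ℝ) ^ j * Q95) = (2 : ℝ) ^ (j + 1) * Q95 := by ring
      _ ≤ (2 : ℝ) ^ J₂ * Q95 := mul_le_mul_of_nonneg_right hj1 hQ0.le
      _ ≤ N := hJ₂N
      _ < X₁ := hX₁
  have hblock_div : ∀ j < J₂, ∑ p ∈ (Nat.primesLE ⌊(2 : ℝ) ^ (j + 1) * Q95⌋₊).filter
      (fun p => ⌊(2 : ℝ) ^ j * Q95⌋₊ < p), (polyRootCountMod ![rabinowitschPoly d] p : ℝ) / p ≤ 4 * Kc := by
    intro j hj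
    obtain ⟨h1, h2', h3⟩ := hxj j hj
    have h := sum_omega_div_block_le_of_chebyshev (d := d) hKc h55 h2' h1 h3
    rwa [show 2 * ((2 : ℝ) ^ j * Q95) = (2 : ℝ) ^ (j + 1) * Q95 by ring] at h
  have hblock : ∀ j < J₂, ∑ p ∈ (Nat.primesLE ⌊(2 : ℝ) ^ (j + 1) * Q95⌋₊).filter
      (fun p => ⌊(2 : ℝ) ^ j * Q95⌋₊ < p), (polyRootCountMod ![rabinowitschPoly d] p : ℝ) ≤
        4 * Kc * ((2 : ℝ) ^ j * Q95) := by
    intro j hj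
    obtain ⟨h1, h2', h3⟩ := hxj j hj
    have h := sum_omega_block_le_of_chebyshev (d := d) hKc h55 h2' h1 h3
    rwa [show 2 * ((2 : ℝ) ^ j * Q95) = (2 : ℝ) ^ (j + 1) * Q95 by ring] at h
  -- (i) `∑ (ω/q') V ≤ V · 4Kc log N / log 2`
  have hJ₂ : (J₂ : ℝ) ≤ Real.log N / Real.log 2 := by
    have h2J : (2 : ℝ) ^ J₂ ≤ N := by
      have : (2 : ℝ) ^ J₂ * 1 ≤ (2 : ℝ) ^ J₂ * Q95 := mul_le_mul_of_nonneg_left hQ1 (by positivity)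
      linarith
    have hlog := Real.log_le_log (by positivity) h2J
    rw [Real.log_pow] at hlog
    rw [le_div_iff₀ (Real.log_pos one_lt_two)]
    exact hlog
  have hdiv : ∑ q' ∈ (Nat.primesLE ⌊u⌋₊).filter (fun q' => ⌊Q95⌋₊ < q'),
      (polyRootCountMod ![rabinowitschPoly d] q' : ℝ) / q' * (fun _ : ℕ => V) q' ≤
        V * (4 * Kc * (Real.log N / Real.log 2)) := by
    simp only []
    rw [← sum_mul, mul_comm]
    refine mul_le_mul_of_nonneg_left ?_ hV0
    refine (sum_le_sum_of_subset_of_nonneg hsub fun _ _ _ => by positivity).trans ?_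
    refine (sum_omega_div_dyadic_le (d := d) hQ0.le J₂ hblock_div).trans ?_
    rw [mul_comm]
    exact mul_le_mul_of_nonneg_left hJ₂ (by positivity)
  -- (ii) the sharp remainder sum `≤ 1536 Kc N`
  have hrem : ∑ q' ∈ (Nat.primesLE ⌊u⌋₊).filter (fun q' => ⌊Q95⌋₊ < q'),
      (polyRootCountMod ![rabinowitschPoly d] q' : ℝ) *
        (Real.sqrt ((N : ℝ) / q') * Real.log ((N : ℝ) / q') ^ 2) ≤ 1536 * Kc * N := by
    refine (sum_le_sum_of_subset_of_nonneg hsub fun _ _ _ => by positivity).trans ?_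
    refine (sum_omega_sqrt_logsq_dyadic_le (d := d) hQ1 (by positivity) J₂ hJ₂N hblock).trans ?_
    have h1 : ((2 : ℝ) ^ J₂ * Q95) ^ ((1 : ℝ) / 4) ≤ (N : ℝ) ^ ((1 : ℝ) / 4) :=
      Real.rpow_le_rpow (by positivity) hJ₂N (by norm_num)
    have h2' : (N : ℝ) ^ ((3 : ℝ) / 4) * (N : ℝ) ^ ((1 : ℝ) / 4) = N := by
      rw [← Real.rpow_add hN0]; norm_num
    calc 384 * (4 * Kc) * (N : ℝ) ^ ((3 : ℝ) / 4) * ((2 : ℝ) ^ J₂ * Q95) ^ ((1 : ℝ) / 4)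
        ≤ 384 * (4 * Kc) * (N : ℝ) ^ ((3 : ℝ) / 4) * (N : ℝ) ^ ((1 : ℝ) / 4) :=
          mul_le_mul_of_nonneg_left h1 (by positivity)
      _ = 1536 * Kc * N := by rw [mul_assoc, h2']; ring
  -- assemble
  have hC0 : 0 ≤ 1 + SieveSequence.flConst 2 (2 * Real.exp (17 + 12 / Real.log 2)) := by
    have := SieveSequence.flConst_pos (κ := 2) (K := 2 * Real.exp (17 + 12 / Real.log 2))
      (by norm_num) (by positivity)
    linarith
  have hmain := mul_le_mul_of_nonneg_left hdiv (show 0 ≤ (1 + SieveSequence.flConst 2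
    (2 * Real.exp (17 + 12 / Real.log 2))) * (N : ℝ) by positivity)
  have hrem' := mul_le_mul_of_nonneg_left hrem (show 0 ≤ Real.exp 8 / 16 by positivity)
  calc (1 + SieveSequence.flConst 2 (2 * Real.exp (17 + 12 / Real.log 2))) * N *
          ∑ q' ∈ (Nat.primesLE ⌊u⌋₊).filter (fun q' => ⌊Q95⌋₊ < q'),
            (polyRootCountMod ![rabinowitschPoly d] q' : ℝ) / q' * (fun _ : ℕ => V) q' +
        Real.exp 8 / 16 * ∑ q' ∈ (Nat.primesLE ⌊u⌋₊).filter (fun q' => ⌊Q95⌋₊ < q'),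
          (polyRootCountMod ![rabinowitschPoly d] q' : ℝ) *
            (Real.sqrt ((N : ℝ) / q') * Real.log ((N : ℝ) / q') ^ 2)
      ≤ (1 + SieveSequence.flConst 2 (2 * Real.exp (17 + 12 / Real.log 2))) * N *
          (V * (4 * Kc * (Real.log N / Real.log 2))) + Real.exp 8 / 16 * (1536 * Kc * N) :=
        add_le_add hmain hrem'
    _ = _ := by ring

/-- **The error term of (6.1), all ranges, sharp form**: as `errorTotal_le`, with the sharp
remainder in the range `q^{9.5} < q' ≤ N/2^{M+1}`:
`IIa' = (1 + Cω) N V · 4K_c log N/log 2 + (e⁸/16) 1536 K_c N`. [cite: GranvilleMollin2000, §6B (6.2)] -/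
theorem errorTotal_le' {d : ℤ} {q N : ℕ} (hdq : d = -(q : ℤ)) (hq8 : q % 8 = 3) (hqN : q ≤ N)
    (hN : 2 ≤ N) {y Kc X₁ H : ℝ} (hy : 2 ≤ y) (hysq : y ≤ Real.sqrt q) (hKc : 0 ≤ Kc)
    (h55 : ∀ t : ℝ, (q : ℝ) ^ ((19 : ℝ) / 2) ≤ t → t < X₁ →
      ∑ p ∈ Nat.primesLE ⌊t⌋₊, (polyRootCountMod ![rabinowitschPoly d] p : ℝ) * Real.log p ≤
        Kc * (t * Real.log t))
    (hX₁ : 2 * (N : ℝ) < X₁)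
    (hH : ∑ p ∈ Nat.primesLE ⌊(q : ℝ) ^ (500 : ℝ)⌋₊,
        (polyRootCountMod ![rabinowitschPoly d] p : ℝ) * Real.log p / p ≤ H)
    (hq95 : 2 ≤ (q : ℝ) ^ ((19 : ℝ) / 2)) (hyq : y ≤ (q : ℝ) ^ ((19 : ℝ) / 2))
    (hN16 : (q : ℝ) ^ ((19 : ℝ) / 2) ≤ (N : ℝ) / 16) {M : ℕ} (hM3 : 3 ≤ M)
    (hMy : (2 : ℝ) ^ M ≤ y ^ 4) (hyM : y ^ 4 < (2 : ℝ) ^ (M + 1))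
    (hxM : (q : ℝ) ^ ((19 : ℝ) / 2) ≤ (N : ℝ) / 2 ^ (M + 1)) :
    ∑ q' ∈ (Nat.primesLE ⌊Real.sqrt 2 * N⌋₊).filter (fun q' => ⌈y⌉₊ ≤ q'),
      ∑ r ∈ (range q').filter (fun r : ℕ => (q' : ℤ) ∣ (rabinowitschPoly d).eval (r : ℤ)),
        (#((apIndex N q' r).filter fun n : ℕ =>
          ((rabinowitschPoly d).eval (n : ℤ)).natAbs.Coprime (primesProdBelow y)) : ℝ) ≤
      17 * (4 * Kc * ((N : ℝ) / 16) * ((2 : ℝ) ^ 5 - 1)) +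
      ((1 + SieveSequence.flConst 2 (2 * Real.exp (17 + 12 / Real.log 2))) * N *
          (∏ p ∈ Nat.primesBelow ⌈y⌉₊, (1 - (polyRootCountMod ![rabinowitschPoly d] p : ℝ) / p)) *
          (H / Real.log y + H / Real.log (Real.sqrt q)) +
        Real.exp 8 * Real.log y ^ 2 * (17 * Real.sqrt N * Real.sqrt ((q : ℝ) ^ ((19 : ℝ) / 2)))) +
      ((1 + SieveSequence.flConst 2 (2 * Real.exp (17 + 12 / Real.log 2))) * N *
          (∏ p ∈ Nat.primesBelow ⌈y⌉₊, (1 - (polyRootCountMod ![rabinowitschPoly d] p : ℝ) / p)) *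
          (4 * Kc * (Real.log N / Real.log 2)) +
        Real.exp 8 / 16 * (1536 * Kc * N)) +
      ((1 + SieveSequence.flConst 2 (2 * Real.exp (17 + 12 / Real.log 2))) * N *
          (4 * Kc * (3 * Real.sqrt ((2 * Real.exp (17 + 12 / Real.log 2)) *
            (∏ p ∈ Nat.primesBelow ⌈y⌉₊, (1 - (polyRootCountMod ![rabinowitschPoly d] p : ℝ) / p)) *
            (4 * Real.log y / Real.log 2) ^ 2) + 1)) +
        Real.exp 8 / 16 * (1536 * Kc * N)) := by
  set Q95 : ℝ := (q : ℝ) ^ ((19 : ℝ) / 2) with hQ95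
  have hy0 : 0 < y := by linarith
  have hy1 : 1 ≤ y := by linarith
  have hN0 : (0 : ℝ) < N := by exact_mod_cast (show 0 < N by omega)
  -- thresholds
  set a₀ : ℕ := ⌈y⌉₊ - 1 with ha₀
  set b₁ : ℕ := ⌊Q95⌋₊ with hb₁
  set b₂ : ℕ := ⌊(N : ℝ) / 2 ^ (M + 1)⌋₊ with hb₂
  set b₃ : ℕ := ⌊(2 : ℝ) ^ (M - 3) * ((N : ℝ) / 2 ^ (M + 1))⌋₊ with hb₃
  set b₄ : ℕ := ⌊(2 : ℝ) ^ 5 * ((N : ℝ) / 16)⌋₊ with hb₄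
  have h16 : (2 : ℝ) ^ (M - 3) * ((N : ℝ) / 2 ^ (M + 1)) = (N : ℝ) / 16 := two_pow_sub_three_mul hM3 N
  have hb₃' : b₃ = ⌊(N : ℝ) / 16⌋₊ := by rw [hb₃, h16]
  have h01 : a₀ ≤ b₁ := by
    have h1 : ⌈y⌉₊ ≤ ⌈Q95⌉₊ := Nat.ceil_mono hyq
    have h2 : ⌈Q95⌉₊ ≤ ⌊Q95⌋₊ + 1 := Nat.ceil_le_floor_add_one _
    omega
  have h12 : b₁ ≤ b₂ := Nat.floor_le_floor hxM
  have h23 : b₂ ≤ b₃ := by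
    rw [hb₃']
    refine Nat.floor_le_floor (div_le_div_of_nonneg_left hN0.le (by norm_num) ?_)
    calc (16 : ℝ) = 2 ^ 4 := by norm_num
      _ ≤ 2 ^ (M + 1) := pow_le_pow_right₀ (by norm_num) (by omega)
  have h34 : b₃ ≤ b₄ := by
    rw [hb₃']
    exact Nat.floor_le_floor (by norm_num; linarith)
  have hsub : (Nat.primesLE ⌊Real.sqrt 2 * N⌋₊).filter (fun q' => ⌈y⌉₊ ≤ q') ⊆
      (Nat.primesLE b₄).filter (fun q' => a₀ < q') := by
    intro p hp
    rw [mem_filter, Nat.mem_primesLE] at hp ⊢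
    have hceil1 : 1 ≤ ⌈y⌉₊ := Nat.one_le_iff_ne_zero.mpr (Nat.ceil_pos.mpr hy0).ne'
    refine ⟨⟨hp.1.1.trans (Nat.floor_le_floor ?_), hp.1.2⟩, by omega⟩
    have hs2 : Real.sqrt 2 ≤ 2 := by
      calc Real.sqrt 2 ≤ Real.sqrt (2 ^ 2) := Real.sqrt_le_sqrt (by norm_num)
        _ = 2 := Real.sqrt_sq (by norm_num)
    calc Real.sqrt 2 * N ≤ 2 * N := mul_le_mul_of_nonneg_right hs2 hN0.le
      _ = (2 : ℝ) ^ 5 * ((N : ℝ) / 16) := by norm_num; ring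
  have hnn : ∀ q' ∈ (Nat.primesLE b₄).filter (fun q' => a₀ < q'),
      0 ≤ ∑ r ∈ (range q').filter (fun r : ℕ => (q' : ℤ) ∣ (rabinowitschPoly d).eval (r : ℤ)),
        (#((apIndex N q' r).filter fun n : ℕ =>
          ((rabinowitschPoly d).eval (n : ℤ)).natAbs.Coprime (primesProdBelow y)) : ℝ) :=
    fun _ _ => sum_nonneg fun _ _ => Nat.cast_nonneg _
  refine (sum_le_sum_of_subset_of_nonneg hsub fun q' hq' _ => hnn q' hq').trans ?_
  rw [sum_primesLE_filter_lt_split (h01.trans (h12.trans h23)) h34,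
    sum_primesLE_filter_lt_split (h01.trans h12) h23, sum_primesLE_filter_lt_split h01 h12]
  have hy4Q : y ^ 4 * Q95 ≤ N := by
    have h2M : (0 : ℝ) < 2 ^ (M + 1) := by positivity
    have : Q95 * 2 ^ (M + 1) ≤ N := (le_div_iff₀ h2M).mp hxM
    nlinarith [hyM, show 0 ≤ Q95 by linarith]
  have hu2 : 2 * ((N : ℝ) / 2 ^ (M + 1)) ≤ N := by
    rw [mul_div_assoc', div_le_iff₀ (by positivity)]
    have : (2 : ℝ) ≤ 2 ^ (M + 1) := by
      calc (2 : ℝ) = 2 ^ 1 := by norm_num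
        _ ≤ 2 ^ (M + 1) := pow_le_pow_right₀ (by norm_num) (by omega)
    nlinarith
  have hyu : y ^ 4 * ((N : ℝ) / 2 ^ (M + 1)) ≤ N := by
    have h2M : (0 : ℝ) < 2 ^ (M + 1) := by positivity
    rw [mul_div_assoc', div_le_iff₀ h2M]
    nlinarith
  have hMylog : (M : ℝ) * Real.log 2 ≤ 4 * Real.log y := by
    have := Real.log_le_log (by positivity) hMy
    rwa [Real.log_pow, Real.log_pow] at this
  have hNX₁ : (N : ℝ) < X₁ := by linarith
  have hI := sum_rangeI_le hdq hq8 hqN hN hy hysq hy4Q hH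
  have hIIa := sum_rangeIIa_le' hdq hq8 hqN hN hy hKc h55 hq95 hyq hxM hu2 hNX₁ hyu
  have hIIb := sum_rangeIIb_le hdq hq8 hqN hN hy hKc h55 hq95 hyq hM3 hMylog hxM hNX₁
  have hP0 := sum_rangeP0_le (d := d) hKc h55 hq95 hN16 hX₁ y
  rw [← hb₃', ← hb₄] at hP0
  rw [← ha₀, ← hb₁] at hI
  rw [← hb₂, ← hb₁] at hIIa
  rw [← hb₃, ← hb₂] at hIIb
  linarith [hI, hIIa, hIIb, hP0]

/-- **The main estimate for Theorem 4, sharp form**: as `abs_polyPrimeCount_sub_mul_le` with the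
error term of `errorTotal_le'`. [cite: GranvilleMollin2000, Theorem 4, §6A–6B] -/
theorem abs_polyPrimeCount_sub_mul_le' {d : ℤ} {q N : ℕ} (hdq : d = -(q : ℤ)) (hq8 : q % 8 = 3)
    (hq7 : 7 ≤ q) (hqN : q ≤ N) (hN : 2 ≤ N) {y Kc X₁ H : ℝ} (hy : 5 ≤ y) (hysq : y ≤ Real.sqrt q)
    (hyN : y ≤ Real.sqrt N) (hKc : 0 ≤ Kc)
    (h55 : ∀ t : ℝ, (q : ℝ) ^ ((19 : ℝ) / 2) ≤ t → t < X₁ →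
      ∑ p ∈ Nat.primesLE ⌊t⌋₊, (polyRootCountMod ![rabinowitschPoly d] p : ℝ) * Real.log p ≤
        Kc * (t * Real.log t))
    (hX₁ : 2 * (N : ℝ) < X₁) (hH0 : 0 ≤ H)
    (hH : ∑ p ∈ Nat.primesLE ⌊(q : ℝ) ^ (500 : ℝ)⌋₊,
        (polyRootCountMod ![rabinowitschPoly d] p : ℝ) * Real.log p / p ≤ H)
    (hq95 : 2 ≤ (q : ℝ) ^ ((19 : ℝ) / 2)) (hyq : y ≤ (q : ℝ) ^ ((19 : ℝ) / 2))
    (hN16 : (q : ℝ) ^ ((19 : ℝ) / 2) ≤ (N : ℝ) / 16) {M : ℕ} (hM3 : 3 ≤ M)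
    (hMy : (2 : ℝ) ^ M ≤ y ^ 4) (hyM : y ^ 4 < (2 : ℝ) ^ (M + 1))
    (hxM : (q : ℝ) ^ ((19 : ℝ) / 2) ≤ (N : ℝ) / 2 ^ (M + 1)) :
    |(polyPrimeCount ![rabinowitschPoly d] N : ℝ) - gmRho d * N| ≤
      (SieveSequence.flConst 2 (2 * Real.exp (17 + 12 / Real.log 2)) * N *
          (∏ p ∈ Nat.primesBelow ⌈y⌉₊, (1 - (polyRootCountMod ![rabinowitschPoly d] p : ℝ) / p)) *
          Real.exp (-(Real.log (Real.sqrt N) / Real.log y)) +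
        Real.sqrt N * (Real.exp 8 * Real.log y ^ 2)) +
      (Real.sqrt y + 1) +
      (17 * (4 * Kc * ((N : ℝ) / 16) * ((2 : ℝ) ^ 5 - 1)) +
      ((1 + SieveSequence.flConst 2 (2 * Real.exp (17 + 12 / Real.log 2))) * N *
          (∏ p ∈ Nat.primesBelow ⌈y⌉₊, (1 - (polyRootCountMod ![rabinowitschPoly d] p : ℝ) / p)) *
          (H / Real.log y + H / Real.log (Real.sqrt q)) +
        Real.exp 8 * Real.log y ^ 2 * (17 * Real.sqrt N * Real.sqrt ((q : ℝ) ^ ((19 : ℝ) / 2)))) +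
      ((1 + SieveSequence.flConst 2 (2 * Real.exp (17 + 12 / Real.log 2))) * N *
          (∏ p ∈ Nat.primesBelow ⌈y⌉₊, (1 - (polyRootCountMod ![rabinowitschPoly d] p : ℝ) / p)) *
          (4 * Kc * (Real.log N / Real.log 2)) +
        Real.exp 8 / 16 * (1536 * Kc * N)) +
      ((1 + SieveSequence.flConst 2 (2 * Real.exp (17 + 12 / Real.log 2))) * N *
          (4 * Kc * (3 * Real.sqrt ((2 * Real.exp (17 + 12 / Real.log 2)) *
            (∏ p ∈ Nat.primesBelow ⌈y⌉₊, (1 - (polyRootCountMod ![rabinowitschPoly d] p : ℝ) / p)) *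
            (4 * Real.log y / Real.log 2) ^ 2) + 1)) +
        Real.exp 8 / 16 * (1536 * Kc * N))) +
      gmRho d * N * (Real.exp (H / Real.log y + 16 / y) - 1) := by
  have hy2 : 2 ≤ y := by linarith
  have hq3 : 3 ≤ q := by omega
  have hy1 : 1 < y := by linarith
  have h1 := rabinowitsch_polyPrimeCount_le hdq hq3 N y
  have h2 := rabinowitsch_card_coprime_le hdq hq7 hqN hN y
  have hE := errorTotal_le' hdq hq8 hqN hN hy2 hysq hKc h55 hX₁ hH hq95 hyq hN16 hM3 hMy hyM hxM
  have h3 := rabinowitsch_abs_card_coprime_sub_le hdq hq8 hqN hy2 hyN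
  have h4 := gmRho_le_prod_primesBelow hdq hq8 hysq
  have hceil1 : 1 ≤ ⌈y⌉₊ := Nat.one_le_iff_ne_zero.mpr (Nat.ceil_pos.mpr (by linarith)).ne'
  have ha₀y : y ≤ ((⌈y⌉₊ - 1 : ℕ) : ℝ) + 1 := by
    have : ((⌈y⌉₊ - 1 : ℕ) : ℝ) + 1 = ⌈y⌉₊ := by push_cast [Nat.cast_sub hceil1]; ring
    rw [this]; exact Nat.le_ceil y
  have hq1 : (1 : ℝ) ≤ q := by exact_mod_cast (show 1 ≤ q by omega)
  have hT : ∑ p ∈ (Nat.primesLE ⌊Real.sqrt q⌋₊).filter (fun p => ⌈y⌉₊ - 1 < p),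
      (polyRootCountMod ![rabinowitschPoly d] p : ℝ) / p ≤ H / Real.log y := by
    refine sum_omega_div_window_le_of_weighted hy1 ha₀y (Nat.floor_le_floor ?_) hH
    rw [Real.sqrt_eq_rpow]; exact Real.rpow_le_rpow_of_exponent_le hq1 (by norm_num)
  have h5 := prod_primesBelow_le_gmRho_mul_exp hdq hq8 hy hysq hT
  have hEnn : 0 ≤ ∑ q' ∈ (Nat.primesLE ⌊Real.sqrt 2 * N⌋₊).filter (fun q' => ⌈y⌉₊ ≤ q'),
      ∑ r ∈ (range q').filter (fun r : ℕ => (q' : ℤ) ∣ (rabinowitschPoly d).eval (r : ℤ)),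
        (#((apIndex N q' r).filter fun n : ℕ =>
          ((rabinowitschPoly d).eval (n : ℤ)).natAbs.Coprime (primesProdBelow y)) : ℝ) :=
    sum_nonneg fun _ _ => sum_nonneg fun _ _ => Nat.cast_nonneg _
  have h1' : (polyPrimeCount ![rabinowitschPoly d] N : ℝ) ≤
      #((Ioc 0 N).filter fun n : ℕ =>
          ((rabinowitschPoly d).eval (n : ℤ)).natAbs.Coprime (primesProdBelow y)) +
        (Real.sqrt y + 1) := by linarith [h1]
  have key := abs_sub_le_of_sandwich h1' h2 h3 h4 h5 (Nat.cast_nonneg N) hEnn (by positivity)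
  have hρ0 : 0 ≤ gmRho d * N := mul_nonneg (gmRho_pos hdq hq8).le (Nat.cast_nonneg N)
  have hexp : 0 ≤ Real.exp (H / Real.log y + 16 / y) - 1 := by
    have : 0 ≤ H / Real.log y + 16 / y := by
      have := Real.log_pos hy1
      positivity
    linarith [Real.add_one_le_exp (H / Real.log y + 16 / y)]
  linarith [key, hE, mul_nonneg hρ0 hexp]

end Literature.Barriers.Parity
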